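/-
Origin: expansion seat `planner-pub-hodgecm-prl1-g2-0`, handover #4 2026-08-18T04:59:54Z (`HOME/pub-hodgecm-prl1-g2/lean/Prl1g2/CorCMCarrier.lean`, md5 10a9df4c, 104 lines);
landed by the gen-6 packager in gate run 22 as `HodgeCM/Assembly/CorCMCarrier.lean` (import ^import Prl1g2\.ThetaCarrier\b→import HodgeCM.Automorphic.ThetaCarrier ×1; import ^import Prl1g2\.→import HodgeCM.Assembly. ×1).
-/
/-
Origin: HOME/pub-hodgecm-prl1-g2/lean/Prl1g2/CorCMCarrier.lean — session planner-pub-hodgecm-prl1-g2-0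
(unit pub-hodgecm-prl1-g2, EXPANSION PROVER a-1 gen 2).
Intended final place (packager's call): `HodgeCM/Assembly/CorCMCarrier.lean`; module renames `Prl1g2.ThetaCarrier` ↦
`HodgeCM.Automorphic.ThetaCarrier`, `Prl1g2.CorCMLeaves` ↦ `HodgeCM.Assembly.CorCMLeaves` (both mine, handed over with /
before this file); `HodgeCM.Assembly.CorCMEndState` is landed (run 19).  NEW, ADDITIVE.

KIND: KERNEL glue (L5 assembly).  NOTHING is cited or posited here; one-line specialisations of audited theorems to the
theta model `ThetaModel.ofCarrier D hA` of a prop-free carrier.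

# The headline theorems with PROP-FREE data binders

For every end-state form already landed over `(T : U.ThetaModel)` this file records the form over
`(D : U.ThetaCarrier) (hA : D.Analytic)`, `T := ThetaModel.ofCarrier D hA`.  In these statements the data binders
`U : Universe` and `D : U.ThetaCarrier` carry NO propositional content (FACTS.md §0 class **data** without the H6/A1–A3
caveat), and EVERY hypothesis is a named proposition left of the colon: the model facts `M : U.ModelAxioms` (+ M29/M30,
the three [QW8]-side inputs), the analytic axioms of PerL v5 §3.3 `hA : D.Analytic` (20 named fields per seesaw context:
`CoreCarrier.Analytic` ×6, `TorusCarrier.Analytic` ×7 on each torus side), the ten theta inputs `A : (ofCarrier D hA).Inputs`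
(or the carver's leaves replacing them), and `hHR : Fact_hodgeRiemann20`.

* `realisationExists_ofCarrier`      : `U.RealisationExistsPerL ∧ U.RealisationExistsFace` (the prl1 target pair);
* `perL_ofCarrier`                   : `U.PerL`;
* `COR_CM_ofCarrier`                 : `U.HC_CM` from `… (hP : U.PohlmannSpan) (hQ : U.Qw8Sufficiency)`;
* `COR_CM_endState_ofCarrier`        : the END STATE `COR_CM_endState` over the carrier;
* `COR_CM_endState_ofCarrier_leaves'`: the END STATE over the carrier with `A` replaced by the carver's leaves
  (`COR_CM_endState_of_leaves'` of `CorCMLeaves.lean`), i.e. with neither a prop-carrying data binder nor an `Inputs` record.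
PROVED; closure = the standard trio.
-/
import Summits.HodgeConjecture.HodgeCM.Automorphic.ThetaCarrier_2
import Summits.HodgeConjecture.HodgeCM.Assembly.CorCMLeaves
import Summits.HodgeConjecture.HodgeCM.Assembly.CorCMEndState

/-! PORT of `HodgeCM/Assembly/CorCMCarrier.lean` (HodgeCMPerL run 82) — verbatim mechanical port; provenance in the PORT header line. -/

set_option autoImplicit false

noncomputable section

namespace HodgeCM
namespace Assembly

open HodgeCM.Prior.Perl34File HodgeCM.Prior.Perl34File.Perl34 HodgeCM.PerL34 HodgeCM.PerL34.ArchC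
open HodgeCM.Universe (ThetaCarrier ThetaModel)

variable (U : Universe)

/-- **Both realisation inputs over a prop-free carrier**: `ThetaModel.realisationExists_of''` at
`T := ThetaModel.ofCarrier D hA`. -/
theorem realisationExists_ofCarrier (M : U.ModelAxioms) (D : U.ThetaCarrier) (hA : D.Analytic)
    (A : (ThetaModel.ofCarrier D hA).Inputs) (hHR : U.Fact_hodgeRiemann20) :
    U.RealisationExistsPerL ∧ U.RealisationExistsFace :=
  (ThetaModel.ofCarrier D hA).realisationExists_of'' M A hHR

/-- **PerL over a prop-free carrier** (`perL_theta''` at `ofCarrier D hA`). -/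
theorem perL_ofCarrier (M : U.ModelAxioms) (D : U.ThetaCarrier) (hA : D.Analytic)
    (A : (ThetaModel.ofCarrier D hA).Inputs) (hHR : U.Fact_hodgeRiemann20) : U.PerL :=
  perL_theta'' U M (ThetaModel.ofCarrier D hA) A hHR

/-- **COR-CM over a prop-free carrier** (`COR_CM_theta''` at `ofCarrier D hA`). -/
theorem COR_CM_ofCarrier (M : U.ModelAxioms) (D : U.ThetaCarrier) (hA : D.Analytic)
    (A : (ThetaModel.ofCarrier D hA).Inputs) (hHR : U.Fact_hodgeRiemann20) (hP : U.PohlmannSpan)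
    (hQ : U.Qw8Sufficiency) : U.HC_CM :=
  COR_CM_theta'' U M (ThetaModel.ofCarrier D hA) A hHR hP hQ

/-- **COR-CM, END STATE over a prop-free carrier**: `COR_CM_endState` at `T := ThetaModel.ofCarrier D hA`.  The data
binders `U`, `D` are prop-free; the hypotheses are `M`, M29/M30, the three [QW8]-side inputs, the analytic axioms `hA`
(PerL v5 §3.3: unitarity of `R`, spectral decomposition of `L²([U(W)])`/`L²([G_U])`, AX9 `e_σ̂ ∈ R''`, AX5b, AX12, AX8,
AX9-at-`w`, per seesaw context), the ten theta inputs `A`, and Hodge–Riemann for `(2,0)`-forms. -/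
theorem COR_CM_endState_ofCarrier (M : U.ModelAxioms) (h29 : U.Fact_weightSpan) (h30 : U.Fact_weightHodge)
    (hE : U.Qw8ExtProd) (hD : U.Qw8DualPushPull) (hMi : U.Qw8Milne) (D : U.ThetaCarrier) (hA : D.Analytic)
    (A : (ThetaModel.ofCarrier D hA).Inputs) (hHR : U.Fact_hodgeRiemann20) : U.HC_CM :=
  COR_CM_endState U M h29 h30 hE hD hMi (ThetaModel.ofCarrier D hA) A hHR

/-- **COR-CM, END STATE over a prop-free carrier, from the leaves**: `COR_CM_endState_of_leaves'` at
`T := ThetaModel.ofCarrier D hA` — no prop-carrying data binder and no `Inputs` record: every hypothesis of the cell's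
headline is a named proposition (model facts, [QW8]-side inputs, the §3.3 analytic axioms `hA`, PRINT leaves
`h07 h09a h09b`, DESIGN `h12b`, `h12a = Open_thetaSub` (S6), model-level `hgen`/`hcore` (S5), archimedean data `Pc A12 A34`
(S4), `h31 : ClusterOutputs` (S3), `h33 : StepsPrintInput` (S1/S2)). -/
theorem COR_CM_endState_ofCarrier_leaves' (M : U.ModelAxioms) (h29 : U.Fact_weightSpan) (h30 : U.Fact_weightHodge)
    (hE : U.Qw8ExtProd) (hD : U.Qw8DualPushPull) (hMi : U.Qw8Milne) (D : U.ThetaCarrier) (hA : D.Analytic)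
    (h07 : N07_hodgeRiemann20 U) (h09a : N09a_embCover (ThetaModel.ofCarrier D hA))
    (h09b : N09b_innerEmb (ThetaModel.ofCarrier D hA))
    (h12a : N12a_thetaSub (ThetaModel.ofCarrier D hA)) (h12b : N12b_signRecipe (ThetaModel.ofCarrier D hA))
    (hgen : ∀ {L : CMField} {ι₁ : L →+* ℂ} (V : HermSpace3 L ι₁) (c : SeesawCtx L),
      (ThetaModel.ofCarrier D hA).GoodCtx ι₁ c →
      N19w_genIdentity (ThetaModel.ofCarrier D hA) V c ((ThetaModel.ofCarrier D hA).t12 V c) 0 1)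
    (hcore : ∀ {L : CMField} {ι₁ : L →+* ℂ} (V : HermSpace3 L ι₁) (c : SeesawCtx L),
      (ThetaModel.ofCarrier D hA).GoodCtx ι₁ c →
      N19g_core (ThetaModel.ofCarrier D hA) V c ((ThetaModel.ofCarrier D hA).t34 V c) 2 3)
    (Pc : ∀ {L : CMField} {ι₁ : L →+* ℂ} (V : HermSpace3 L ι₁) (c : SeesawCtx L),
      C4a.PointedCore ((ThetaModel.ofCarrier D hA).core V c))
    (A12 : ∀ {L : CMField} {ι₁ : L →+* ℂ} (V : HermSpace3 L ι₁) (c : SeesawCtx L),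
      (ThetaModel.ofCarrier D hA).GoodCtx ι₁ c →
      Nonempty (ArchCDatum ((ThetaModel.ofCarrier D hA).core V c) ((ThetaModel.ofCarrier D hA).t12 V c) (Pc V c)))
    (A34 : ∀ {L : CMField} {ι₁ : L →+* ℂ} (V : HermSpace3 L ι₁) (c : SeesawCtx L),
      (ThetaModel.ofCarrier D hA).GoodCtx ι₁ c →
      Nonempty (ArchCDatum ((ThetaModel.ofCarrier D hA).core V c) ((ThetaModel.ofCarrier D hA).t34 V c) (Pc V c)))
    (h31 : ClusterOutputs (ThetaModel.ofCarrier D hA))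
    (h33 : WedgeToClasses.StepsPrintInput (ThetaModel.ofCarrier D hA)) : U.HC_CM :=
  COR_CM_endState_of_leaves' U M h29 h30 hE hD hMi (ThetaModel.ofCarrier D hA) h07 h09a h09b h12a h12b hgen hcore
    Pc A12 A34 h31 h33

end Assembly
end HodgeCM

end
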